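import Summits.ValiantsHypothesis.ValiantsHypothesis.Theorems.BarrierLeverChowHitsThinRowPartitionMinorsRNearFull

/-!
# Route BarrierLever — item `ChowHitsThinRowPartitionMinorsR` (stmt-ValiantsHypothesis-21850, budget
# `h·h`): AFFINE DEFECT TWO — one x-dedicated pair row pays for two public forms

Helper file (`--supports stmt-ValiantsHypothesis-21850`; cell valiant-natproofs, rung V4, 𝒟-side;
seat val-np-p5 gen 28).  Closes NO item; definition-free; imports this seat's `…RNearFull`.

`chowHitsHH_of_defectOne` (p695712) had one form to spare: the x-dedicated pair saves TWO gadget forms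
and the labelled certificate with all used singletons costs exactly `h·h`.  Hence the same relabelling
proves **`chowHitsHH_of_defectLeTwo`**: rows with a triangle `{a},{b},{a,b}`, `r ≥ h + 2`, and a
down-closed injective monomial basis `U` (`det [U i ⊆ w j] ≠ 0`) holding the singleton of every used
coordinate outside a set `Dx` of size `≤ 2` ⇒ hit by `h·h` affine forms (budget
`≤ (h + 2) + 2·(C(h,2) − 1) = h·h`).  **`chowHitsHH_of_nearFull_defectLeTwo`**: the same for all
near-full row families (`h ≥ 3`), by `exists_triangle_of_nearFull`, `le_rows_of_nearFull`,
`chowHitsHH_of_singleRow` (p696562).  So the registered residual stubs of line `antipodal_gadget` hold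
in affine defect ≤ 2; the residual is near-full rows × defect ≥ 3.

WHAT THIS IS NOT: item 21850 is NOT proved; nothing on items 21882 / 19717, on crux
stmt-ValiantsHypothesis-14610, or on `VP` versus `VNP`.
-/

set_option linter.dupNamespace false

namespace Summit.ValiantsHypothesis.ValiantsHypothesis.Theorems.BarrierLever.ChowThinHH

open Finset MvPolynomial

variable {h r : ℕ}

/-- **Affine defect two ⇒ hit** (see the module docstring): one x-dedicated pair row pays for TWO public
forms. -/
theorem chowHitsHH_of_defectLeTwo (h r : ℕ) (u w : Fin r → Finset (Fin h))
    (hu : Function.Injective u) (hu2 : ∀ i, (u i).card ≤ 2)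
    (U : Fin r → Finset (Fin h)) (hUinj : Function.Injective U)
    (hUdown : ∀ i (S : Finset (Fin h)), S ⊆ U i → ∃ i', U i' = S)
    (hZ : (Matrix.of fun i j : Fin r => if U i ⊆ w j then (1 : ℂ) else 0).det ≠ 0)
    (Dx : Finset (Fin h)) (hDx : Dx.card ≤ 2)
    (hUsing : ∀ c ∈ Finset.univ.biUnion w, c ∉ Dx → ∃ i, U i = {c})
    (hr : h + 2 ≤ r) (s₁ s₂ p : Fin r) (hs₁ : (u s₁).card = 1) (hs₂ : (u s₂).card = 1)
    (hs12 : s₁ ≠ s₂) (hp : u p = u s₁ ∪ u s₂) :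
    ∃ ℓ : Fin (h * h) → MvPolynomial (Fin (h + h)) ℂ, (∀ k, (ℓ k).totalDegree ≤ 1) ∧
      (Matrix.of fun i j : Fin r => MvPolynomial.coeff
        (∑ a ∈ u i, Finsupp.single (Fin.castAdd h a) 1 +
          ∑ c ∈ w j, Finsupp.single (Fin.natAdd h c) 1) (∏ k, ℓ k)).det ≠ 0 := by
  classical
  set Sing : Finset (Fin r) := Finset.univ.filter fun i : Fin r => (u i).card = 1 with hSing
  set SLab : Finset (Fin r) := Finset.univ.filter fun j : Fin r => (U j).card = 1 with hSLab
  set Cu : Finset (Fin h) := Finset.univ.biUnion w with hCu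
  -- the pair row `p`
  obtain ⟨a, ha⟩ := Finset.card_eq_one.mp hs₁
  obtain ⟨b, hb⟩ := Finset.card_eq_one.mp hs₂
  have hab : a ≠ b := fun e => hs12 (hu (by rw [ha, hb, e]))
  have hp2 : (u p).card = 2 := by
    rw [hp, ha, hb, show ({a} : Finset (Fin h)) ∪ {b} = {a, b} from rfl, Finset.card_pair hab]
  -- a pair label `{v₁, v₂}` and its two singleton sub-labels
  obtain ⟨j0, hj0⟩ := exists_two_le_card U hUinj hr
  obtain ⟨Vp, hVpsub, hVpcard⟩ := Finset.exists_subset_card_eq hj0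
  obtain ⟨jp, hjp⟩ := hUdown j0 Vp hVpsub
  obtain ⟨v₁, v₂, hv12, hVp⟩ := Finset.card_eq_two.mp hVpcard
  obtain ⟨j₁, hj₁⟩ := hUdown jp {v₁} (by rw [hjp, hVp]; simp)
  obtain ⟨j₂, hj₂⟩ := hUdown jp {v₂} (by rw [hjp, hVp]; simp)
  have hj12 : j₁ ≠ j₂ := fun e => hv12 (Finset.singleton_injective (hj₁.symm.trans (e ▸ hj₂)))
  -- a singleton label is a used singleton
  have hlab_used : ∀ i c, U i = {c} → c ∈ Cu := by
    intro i c hic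
    by_contra hc
    apply hZ
    refine Matrix.det_eq_zero_of_row_eq_zero i fun j => ?_
    rw [Matrix.of_apply, if_neg]
    intro hsub
    apply hc
    rw [hCu, Finset.mem_biUnion]
    exact ⟨j, Finset.mem_univ _, hsub (by rw [hic]; exact Finset.mem_singleton_self c)⟩
  have hSLabCu : SLab.image U ⊆ Cu.image fun c : Fin h => ({c} : Finset (Fin h)) := by
    intro S hS
    obtain ⟨j, hj, rfl⟩ := Finset.mem_image.mp hS
    obtain ⟨c, hc⟩ := Finset.card_eq_one.mp (Finset.mem_filter.mp hj).2
    exact Finset.mem_image.mpr ⟨c, hlab_used j c hc, hc.symm⟩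
  have hCuSLab : (Cu \ Dx).image (fun c : Fin h => ({c} : Finset (Fin h))) ⊆ SLab.image U := by
    intro S hS
    obtain ⟨c, hc, rfl⟩ := Finset.mem_image.mp hS
    obtain ⟨j, hj⟩ := hUsing c (Finset.mem_sdiff.mp hc).1 (Finset.mem_sdiff.mp hc).2
    exact Finset.mem_image.mpr ⟨j, Finset.mem_filter.mpr ⟨Finset.mem_univ _, by rw [hj]; rfl⟩, hj⟩
  -- matching of the remaining singleton labels with the remaining singleton rows
  set SLab' : Finset (Fin r) := (SLab.erase j₁).erase j₂ with hSLab'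
  set Sing' : Finset (Fin r) := (Sing.erase s₁).erase s₂ with hSing'
  obtain ⟨M, hMsub, hMcard, g, hg⟩ : ∃ M : Finset (Fin r), M ⊆ Sing' ∧
      M.card = min Sing'.card SLab'.card ∧ ∃ g : Fin r → Fin r, Set.InjOn g M ∧ ∀ i ∈ M, g i ∈ SLab' := by
    obtain ⟨M, hMsub, hMcard⟩ := Finset.exists_subset_card_eq
      (show min Sing'.card SLab'.card ≤ Sing'.card from min_le_left _ _)
    have hle : M.card ≤ SLab'.card := by rw [hMcard]; exact min_le_right _ _
    have hc : Fintype.card M ≤ Fintype.card SLab' := by simpa using hle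
    obtain ⟨ι⟩ := Function.Embedding.nonempty_of_card_le hc
    refine ⟨M, hMsub, hMcard, fun i => if hi : i ∈ M then (ι ⟨i, hi⟩ : Fin r) else i, ?_, ?_⟩
    · intro i hi i' hi' e
      simp only [dif_pos (show i ∈ M from hi), dif_pos (show i' ∈ M from hi')] at e
      have := ι.injective (Subtype.ext e)
      exact congrArg Subtype.val this
    · intro i hi
      simp only [dif_pos hi]
      exact (ι ⟨i, hi⟩).2
  obtain ⟨je, hje⟩ : ∃ j, U j = ∅ := hUdown jp ∅ (Finset.empty_subset _)
  -- the card-1 class: `M' = M ∪ {s₁, s₂}` matched injectively into `SLab` by `g'`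
  set g' : Fin r → Fin r := fun i => if i = s₁ then j₁ else if i = s₂ then j₂ else g i with hg'
  set M' : Finset (Fin r) := insert s₁ (insert s₂ M) with hM'
  have hMns : ∀ i ∈ M, i ≠ s₁ ∧ i ≠ s₂ ∧ (u i).card = 1 := by
    intro i hi
    have hi' := hMsub hi
    simp only [hSing', Finset.mem_erase, hSing, Finset.mem_filter, Finset.mem_univ, true_and] at hi'
    exact ⟨hi'.2.1, hi'.1, hi'.2.2⟩
  have hg'M : ∀ i ∈ M, g' i = g i := fun i hi => by
    simp only [hg', if_neg (hMns i hi).1, if_neg (hMns i hi).2.1]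
  have hg's1 : g' s₁ = j₁ := by simp only [hg', if_true]
  have hg's2 : g' s₂ = j₂ := by simp only [hg', if_neg hs12.symm, if_true]
  have hg'SLab : ∀ i ∈ M', g' i ∈ SLab := by
    intro i hi
    rcases Finset.mem_insert.mp hi with rfl | hi
    · rw [hg's1]; exact Finset.mem_filter.mpr ⟨Finset.mem_univ _, by rw [hj₁]; rfl⟩
    rcases Finset.mem_insert.mp hi with rfl | hi
    · rw [hg's2]; exact Finset.mem_filter.mpr ⟨Finset.mem_univ _, by rw [hj₂]; rfl⟩
    · rw [hg'M i hi]
      exact Finset.mem_of_mem_erase (Finset.mem_of_mem_erase (hg.2 i hi))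
  have hM'card1 : ∀ i ∈ M', (u i).card = 1 := by
    intro i hi
    rcases Finset.mem_insert.mp hi with rfl | hi
    · exact hs₁
    rcases Finset.mem_insert.mp hi with rfl | hi
    · exact hs₂
    · exact (hMns i hi).2.2
  have hg'inj : Set.InjOn g' M' := by
    intro i hi i' hi' e
    have hgM' : ∀ k ∈ M, g' k ≠ j₁ ∧ g' k ≠ j₂ := fun k hk => by
      have hgk := hg.2 k hk
      rw [hg'M k hk]
      exact ⟨Finset.ne_of_mem_erase (Finset.mem_of_mem_erase hgk), Finset.ne_of_mem_erase hgk⟩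
    simp only [hM', Finset.coe_insert, Set.mem_insert_iff, Finset.mem_coe] at hi hi'
    rcases hi with rfl | rfl | hi <;> rcases hi' with rfl | rfl | hi'
    · rfl
    · exact absurd (hg's1.symm.trans (e.trans hg's2)) hj12
    · exact absurd (hg's1.symm.trans e).symm (hgM' _ hi').1
    · exact absurd (hg's2.symm.trans (e.trans hg's1)) hj12.symm
    · rfl
    · exact absurd (hg's2.symm.trans e).symm (hgM' _ hi').2
    · exact absurd (hg's1.symm.trans e.symm).symm (hgM' _ hi).1
    · exact absurd (hg's2.symm.trans e.symm).symm (hgM' _ hi).2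
    · exact hg.1 hi hi' (by rw [← hg'M _ hi, ← hg'M _ hi', e])
  -- the row → label assignment on the constrained rows `C`
  set Zr : Finset (Fin r) := Finset.univ.filter fun i : Fin r => u i = ∅ with hZr
  set C : Finset (Fin r) := Zr ∪ (insert p M') with hC
  set f : Fin r → Fin r := fun i => if u i = ∅ then je else if i = p then jp else g' i with hf
  have hnep : u p ≠ ∅ := fun e => by rw [e, Finset.card_empty] at hp2; exact absurd hp2 (by norm_num)
  have hM'ne : ∀ i ∈ M', u i ≠ ∅ ∧ i ≠ p := fun i hi =>
    ⟨fun e => by have := hM'card1 i hi; rw [e, Finset.card_empty] at this; exact absurd this (by norm_num),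
     fun e => by have := hM'card1 i hi; rw [e, hp2] at this; exact absurd this (by norm_num)⟩
  have hfZ : ∀ i, u i = ∅ → f i = je := fun i hi => by simp only [hf, if_pos hi]
  have hfp : f p = jp := by simp only [hf, if_neg hnep, if_true]
  have hfM' : ∀ i ∈ M', f i = g' i := fun i hi => by
    simp only [hf, if_neg (hM'ne i hi).1, if_neg (hM'ne i hi).2]
  have hcardSLab : ∀ j ∈ SLab, (U j).card = 1 := fun j hj => (Finset.mem_filter.mp hj).2
  have hinj : Set.InjOn f C := by
    intro i hi i' hi' e
    have hcls : ∀ k, k ∈ (C : Set (Fin r)) → u k ≠ ∅ → k ≠ p → k ∈ M' := by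
      intro k hk hk0 hkp
      simp only [hC, Finset.coe_union, Set.mem_union, Finset.mem_coe, hZr, Finset.mem_filter,
        Finset.mem_univ, true_and, Finset.mem_insert] at hk
      rcases hk with hk | rfl | hk
      · exact absurd hk hk0
      · exact absurd rfl hkp
      · exact hk
    by_cases hi0 : u i = ∅ <;> by_cases hi0' : u i' = ∅
    · exact hu (hi0.trans hi0'.symm)
    · exfalso
      have e1 : (U (f i')).card = 0 := by rw [← e, hfZ i hi0, hje, Finset.card_empty]
      by_cases hip : i' = p
      · rw [hip, hfp, hjp, hVpcard] at e1; exact absurd e1 (by norm_num)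
      · rw [hfM' i' (hcls i' hi' hi0' hip), hcardSLab _ (hg'SLab i' (hcls i' hi' hi0' hip))] at e1
        exact absurd e1 (by norm_num)
    · exfalso
      have e1 : (U (f i)).card = 0 := by rw [e, hfZ i' hi0', hje, Finset.card_empty]
      by_cases hip : i = p
      · rw [hip, hfp, hjp, hVpcard] at e1; exact absurd e1 (by norm_num)
      · rw [hfM' i (hcls i hi hi0 hip), hcardSLab _ (hg'SLab i (hcls i hi hi0 hip))] at e1
        exact absurd e1 (by norm_num)
    · by_cases hip : i = p <;> by_cases hip' : i' = p
      · rw [hip, hip']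
      · exfalso
        have e1 : (U (f i')).card = 2 := by rw [← e, hip, hfp, hjp, hVpcard]
        rw [hfM' i' (hcls i' hi' hi0' hip'), hcardSLab _ (hg'SLab i' (hcls i' hi' hi0' hip'))] at e1
        exact absurd e1 (by norm_num)
      · exfalso
        have e1 : (U (f i)).card = 2 := by rw [e, hip', hfp, hjp, hVpcard]
        rw [hfM' i (hcls i hi hi0 hip), hcardSLab _ (hg'SLab i (hcls i hi hi0 hip))] at e1
        exact absurd e1 (by norm_num)
      · have hiM := hcls i hi hi0 hip
        have hiM' := hcls i' hi' hi0' hip'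
        rw [hfM' i hiM, hfM' i' hiM'] at e
        exact hg'inj hiM hiM' e
  obtain ⟨ge, hge⟩ := Finset.exists_equiv_extend_of_card_eq (t := (Finset.univ : Finset (Fin r)))
    (by simp) (s := C) (f := f) (Finset.subset_univ _) hinj
  set π : Fin r ≃ Fin r := ge.trans (Equiv.subtypeUnivEquiv Finset.mem_univ) with hπ
  have hπC : ∀ i ∈ C, π i = f i := by
    intro i hi
    rw [← hge i hi]
    rfl
  have hpC : p ∈ C := Finset.mem_union_right _ (Finset.mem_insert_self _ _)
  have hM'C : ∀ i ∈ M', i ∈ C := fun i hi => Finset.mem_union_right _ (Finset.mem_insert_of_mem hi)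
  have hs1M' : s₁ ∈ M' := Finset.mem_insert_self _ _
  have hs2M' : s₂ ∈ M' := Finset.mem_insert_of_mem (Finset.mem_insert_self _ _)
  -- the relabelling
  set U' : Fin r → Finset (Fin h) := fun i => U (π i) with hU'
  have hU'inj : Function.Injective U' := hUinj.comp π.injective
  have hU'down : ∀ i (S : Finset (Fin h)), S ⊆ U' i → ∃ i', U' i' = S := by
    intro i S hS
    obtain ⟨j', hj'⟩ := hUdown (π i) S hS
    exact ⟨π.symm j', by simp only [hU', Equiv.apply_symm_apply, hj']⟩
  have hU'empty : ∀ i, u i = ∅ → U' i = ∅ := by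
    intro i hi
    have hiC : i ∈ C := Finset.mem_union_left _ (Finset.mem_filter.mpr ⟨Finset.mem_univ _, hi⟩)
    show U (π i) = ∅
    rw [hπC i hiC, hfZ i hi, hje]
  have hU's1 : U' s₁ = {v₁} := by
    show U (π s₁) = {v₁}; rw [hπC s₁ (hM'C _ hs1M'), hfM' _ hs1M', hg's1, hj₁]
  have hU's2 : U' s₂ = {v₂} := by
    show U (π s₂) = {v₂}; rw [hπC s₂ (hM'C _ hs2M'), hfM' _ hs2M', hg's2, hj₂]
  have hU'p : U' p = {v₁, v₂} := by
    show U (π p) = {v₁, v₂}; rw [hπC p hpC, hfp, hjp, hVp]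
  have hU'M' : ∀ i ∈ M', U' i ∈ Cu.image fun c : Fin h => ({c} : Finset (Fin h)) := by
    intro i hi
    apply hSLabCu
    refine Finset.mem_image.mpr ⟨π i, ?_, rfl⟩
    rw [hπC i (hM'C i hi), hfM' i hi]
    exact hg'SLab i hi
  have hZ' : (Matrix.of fun i j : Fin r => if U' i ⊆ w j then (1 : ℂ) else 0).det ≠ 0 := by
    have e : (Matrix.of fun i j : Fin r => if U' i ⊆ w j then (1 : ℂ) else 0) =
        (Matrix.of fun i j : Fin r => if U i ⊆ w j then (1 : ℂ) else 0).submatrix π id := by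
      ext i j
      rfl
    rw [e, Matrix.det_permute]
    refine mul_ne_zero ?_ hZ
    rcases Int.units_eq_one_or (Equiv.Perm.sign π) with h1 | h1 <;> simp [h1]
  -- apply the x-dedicated certificate with `Xd = {p}`
  refine chowHitsHH_of_labels_xded h r u w hu hu2 U' hU'inj hU'down hU'empty hZ' {p}
    (fun i hi => by rw [Finset.mem_singleton.mp hi]; exact hp2) ?_ ?_
  · intro i hi
    rw [Finset.mem_singleton.mp hi]
    refine ⟨s₁, s₂, hs₁, hs₂, hp, ?_, ?_⟩
    · rw [hU'p, hU's1, hU's2]; rfl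
    · rw [hU's1, hU's2]; exact Finset.disjoint_singleton.mpr hv12
  -- budget: `|Sing.image U' ∪ Cu.image singleton| ≤ h + 1` and `2·(#pairs − 1) ≤ h·h − h − 2`
  have hSing_le : Sing.card ≤ h := by
    rw [← Finset.card_image_of_injective _ hu]
    refine (Finset.card_le_card ?_).trans
      (Finset.card_image_le.trans (by rw [Finset.card_univ, Fintype.card_fin]) :
        (Finset.univ.image fun c : Fin h => ({c} : Finset (Fin h))).card ≤ h)
    intro S hS
    obtain ⟨i, hi, rfl⟩ := Finset.mem_image.mp hS
    obtain ⟨c, hc⟩ := Finset.card_eq_one.mp (Finset.mem_filter.mp hi).2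
    exact Finset.mem_image.mpr ⟨c, Finset.mem_univ _, hc.symm⟩
  have hCu_le : Cu.card ≤ SLab.card + 2 := by
    have h1 : ((Cu \ Dx).image fun c : Fin h => ({c} : Finset (Fin h))).card ≤ (SLab.image U).card :=
      Finset.card_le_card hCuSLab
    rw [Finset.card_image_of_injective _ (Finset.singleton_injective), Finset.card_image_of_injective _ hUinj]
      at h1
    have h3 : Cu.card ≤ (Cu \ Dx).card + Dx.card := by
      have := Finset.card_le_card_sdiff_add_card (s := Cu) (t := Dx)
      exact this
    omega
  have hM'sub : M' ⊆ Sing := by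
    intro i hi
    exact Finset.mem_filter.mpr ⟨Finset.mem_univ _, hM'card1 i hi⟩
  have hCu_h : Cu.card ≤ h := (Finset.card_le_univ _).trans (by rw [Fintype.card_fin])
  have hM'card : M'.card = M.card + 2 := by
    rw [hM', Finset.card_insert_of_notMem, Finset.card_insert_of_notMem]
    · exact fun hm => (hMns s₂ hm).2.1 rfl
    · rw [Finset.mem_insert, not_or]
      exact ⟨hs12, fun hm => (hMns s₁ hm).1 rfl⟩
  have hsub : Sing.image U' ∪ Cu.image (fun c : Fin h => ({c} : Finset (Fin h))) ⊆
      (Sing \ M').image U' ∪ Cu.image (fun c : Fin h => ({c} : Finset (Fin h))) := by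
    intro S hS
    rcases Finset.mem_union.mp hS with h1 | h2
    · obtain ⟨i, hi, rfl⟩ := Finset.mem_image.mp h1
      by_cases hiM : i ∈ M'
      · exact Finset.mem_union_right _ (hU'M' i hiM)
      · exact Finset.mem_union_left _ (Finset.mem_image.mpr ⟨i, Finset.mem_sdiff.mpr ⟨hi, hiM⟩, rfl⟩)
    · exact Finset.mem_union_right _ h2
  have hSing'card : Sing'.card + 2 = Sing.card := by
    have h1 : s₂ ∈ Sing.erase s₁ := Finset.mem_erase.mpr ⟨hs12.symm, Finset.mem_filter.mpr ⟨Finset.mem_univ _, hs₂⟩⟩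
    have h2 : s₁ ∈ Sing := Finset.mem_filter.mpr ⟨Finset.mem_univ _, hs₁⟩
    rw [hSing', ← Finset.card_erase_add_one h2, ← Finset.card_erase_add_one h1]
  have hSLab'card : SLab'.card + 2 = SLab.card := by
    have h2 : j₁ ∈ SLab := Finset.mem_filter.mpr ⟨Finset.mem_univ _, by rw [hj₁]; rfl⟩
    have h1 : j₂ ∈ SLab.erase j₁ := Finset.mem_erase.mpr ⟨hj12.symm, Finset.mem_filter.mpr ⟨Finset.mem_univ _, by rw [hj₂]; rfl⟩⟩
    rw [hSLab', ← Finset.card_erase_add_one h2, ← Finset.card_erase_add_one h1]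
  have hbound : (Sing.image U' ∪ Cu.image (fun c : Fin h => ({c} : Finset (Fin h)))).card ≤ h + 2 := by
    refine (Finset.card_le_card hsub).trans ((Finset.card_union_le _ _).trans ?_)
    refine (Nat.add_le_add Finset.card_image_le Finset.card_image_le).trans ?_
    rw [Finset.card_sdiff_of_subset hM'sub, hM'card, hMcard]
    rcases le_total Sing'.card SLab'.card with hle | hle
    · rw [min_eq_left hle]; omega
    · rw [min_eq_right hle]; omega
  have hpairs := card_pairRows_le u hu
  have hpmem : p ∈ (Finset.univ.filter fun i : Fin r => (u i).card = 2) :=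
    Finset.mem_filter.mpr ⟨Finset.mem_univ _, hp2⟩
  have hT : ((Finset.univ.filter fun i : Fin r => (u i).card = 2) \ {p}).card + 1 =
      (Finset.univ.filter fun i : Fin r => (u i).card = 2).card := by
    rw [Finset.sdiff_singleton_eq_erase, Finset.card_erase_add_one hpmem]
  have h3 := add_two_mul_choose_two h
  show (Sing.image U' ∪ Cu.image (fun c : Fin h => ({c} : Finset (Fin h)))).card +
      2 * ((Finset.univ.filter fun i : Fin r => (u i).card = 2) \ {p}).card ≤ h * h
  omega


/-- **Near-full rows of affine defect at most two are hit** (`h ≥ 3`); cf.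
`chowHitsHH_of_nearFull_defectLeOne`. -/
theorem chowHitsHH_of_nearFull_defectLeTwo (h r : ℕ) (u w : Fin r → Finset (Fin h))
    (hu : Function.Injective u) (hu2 : ∀ i, (u i).card ≤ 2) (h3 : 3 ≤ h)
    (hnear : h * h < (Finset.univ.filter fun i : Fin r => (u i).card = 1).card + h +
      2 * (Finset.univ.filter fun i : Fin r => (u i).card = 2).card)
    (U : Fin r → Finset (Fin h)) (hUinj : Function.Injective U)
    (hUdown : ∀ i (S : Finset (Fin h)), S ⊆ U i → ∃ i', U i' = S)
    (hZ : (Matrix.of fun i j : Fin r => if U i ⊆ w j then (1 : ℂ) else 0).det ≠ 0)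
    (Dx : Finset (Fin h)) (hDx : Dx.card ≤ 2)
    (hUsing : ∀ c ∈ Finset.univ.biUnion w, c ∉ Dx → ∃ i, U i = {c}) :
    ∃ ℓ : Fin (h * h) → MvPolynomial (Fin (h + h)) ℂ, (∀ k, (ℓ k).totalDegree ≤ 1) ∧
      (Matrix.of fun i j : Fin r => MvPolynomial.coeff
        (∑ a ∈ u i, Finsupp.single (Fin.castAdd h a) 1 +
          ∑ c ∈ w j, Finsupp.single (Fin.natAdd h c) 1) (∏ k, ℓ k)).det ≠ 0 := by
  classical
  have hcard := card_singles_add_pairs_le u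
  have hC := add_two_mul_choose_two h
  have hp := card_pairRows_le u hu
  rcases Nat.lt_or_ge (Finset.univ.filter fun i : Fin r => (u i).card = 1).card 2 with hlt | hge
  · have hs1 : (Finset.univ.filter fun i : Fin r => (u i).card = 1).card = 1 := by omega
    have hh : 3 * h ≤ h * h := Nat.mul_le_mul_right h h3
    exact chowHitsHH_of_singleRow h r u w hu hu2 hs1.le (by omega) U hUinj hUdown hZ
  · obtain ⟨s₁, s₂, p, hs₁, hs₂, hs12, hp12⟩ := exists_triangle_of_nearFull u hu hnear (by omega)
    exact chowHitsHH_of_defectLeTwo h r u w hu hu2 U hUinj hUdown hZ Dx hDx hUsing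
      (le_rows_of_nearFull u hu h3 hnear hge) s₁ s₂ p hs₁ hs₂ hs12 hp12

end Summit.ValiantsHypothesis.ValiantsHypothesis.Theorems.BarrierLever.ChowThinHH
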